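import Summits.BirchSwinnertonDyer.BirchSwinnertonDyer.Theorems.Rank1ResidualJetCarrierLevelLiterature
import Summits.BirchSwinnertonDyer.Rank1Residual.JET.CarrierReadingRecordsKit
import HarnessLib

/-!
# T1 JET (cell `bsd-jet`), road «R-IDX» record kit at `p ≥ 5` ⟸ NAMED PRINT ONLY: the two-engine
# HEEGNER-INDEX row doors `bsdp_of_jetRowA5_tam_min` ∕ `bsdp_of_jetRowB5_tam_min` with the reading binder
# (K1 ∕ K3), the Kolyvagin–McCallum structure fact, Shimura reciprocity, Darmon 3.6 and Carayol all FED

HONEST FRAMING (programme `BSD-LIT2PART-PROGRAMME-v1.md` §HONESTY, verbatim): «no tranche here proves BSD;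
ARM L moves the LITERAL column of an r ≤ 1 census into the kernel-proved-modulo-named-print column; ARM P
changes what «named print» is worth.» THEOREMS ONLY (seat `bsd-jet-pv-1`, session g9;
`--supports stmt-BirchSwinnertonDyer-14418`, helper); nothing is booked by this file; 0 classes move; per
pair, no class statement; whether a row books is referee A's word.

WHAT. ty's record kit `JET.bsdp_of_jetRowA5_tam_min` ∕ `…B5…` (`JET/CarrierReadingRecordsKit`, p468192; the
door behind every landed `JET.bsdpJ_<label>_<p>` ∕ `JET.bsdp_jr…` record at `p ≥ 5`) displays, besides the
kernel-checked certificate (Serre witnesses, `TamLocal`), the binders {`hJ` (READING K1 ∕ K3), `hMcU`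
(McCallum Cor. 5.6), `hGZK`, `hKo`, `hrec`, `hD36`, `hlev`}. THIS FILE re-issues both doors with `hJ` fed by
road K's END FORMS, `hMcU` replaced by the divided descent (pv-1 g9), `hrec` ∕ `hD36` by the Literature
theorems and `hlev` by modularity — over `JET.bsdp_of_carrier{Ne,Mult}Certificate_level…_of_literature`
(`Rank1ResidualJetCarrierLevelLiterature`); bodies = the kit's, byte for byte, up to the final call.
Displayed named print of a `p ≥ 5` JET record after this file: {`h52` [McC] Prop. 5.2, `hPT` Poitou–Tate
for Selmer structures (∀ K), `hF1` [GZ86 III (3.1)], `h372` Gross Prop. 3.7 (2), `hGZK`, `hKo` Kolyvagin,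
`hmod` modularity}. A landed record `bsdpJ_<label>_<p> hJ hMcU hGZK hKo hrec hD36 hlev W rfl …` is re-derived
as `bsdp_of_jetRowA5_tam_min_literature … h52 hPT hF1 h372 hGZK hKo hmod W rfl …` with the same certificate
arguments. References: [cite: Jetchev2008, Thm. 1.4, Cor. 1.5 (p. 812)] [cite: Serre1972, §2.8 Prop. 19]
[cite: SilvermanATAEC1994, IV.9.4] [cite: McCallumLMS1991, Prop. 5.2, Cor. 5.6] [cite: Miller2011LMS, Def. 1.1]
[cite: DiamondShurman2005, Thm. 8.8.1]. Design: no definitions. Axioms: `propext`, `Classical.choice`, `Quot.sound`.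
-/

set_option autoImplicit false

noncomputable section

open scoped Classical

open WeierstrassCurve Literature.NumberTheory.EllipticCurves
  Literature.NumberTheory.EllipticCurves.ModularForms Literature.NumberTheory.GaloisCohomology
  Literature.NumberTheory.EllipticCurves.Rank1Residual
  Literature.NumberTheory.EllipticCurves.Rank1Residual.Typed
  Literature.NumberTheory.EllipticCurves.Rank1Residual.X11RankOneCertificates
  Summit.BirchSwinnertonDyer.BirchSwinnertonDyer.Rank1Residual
  Summit.BirchSwinnertonDyer.BirchSwinnertonDyer.Rank1Residual.IntModel
  Summit.BirchSwinnertonDyer.BirchSwinnertonDyer.Rank1Residual.X11RankOne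
  Summit.BirchSwinnertonDyer.BirchSwinnertonDyer.Rank2Observatory.Tam
  Summit.BirchSwinnertonDyer.Rank1Residual Summit.BirchSwinnertonDyer.Rank1Residual.X11b

namespace Summit.BirchSwinnertonDyer.Rank1Residual.JET

/-- **Bucket A, `p ≥ 5`: `BSD(E,p)` for a literal integer model from the two-engine HEEGNER-INDEX line
through named print only** — `bsdp_of_jetRowA5_tam_min` with {`hJ`, `hMcU`, `hrec`, `hD36`, `hlev`} fed
(module docstring); certificate inputs (three Serre witnesses, one `TamLocal` certificate at `q ≠ p`,
`w ≤ ord_p c`, the index line `ord_p [E(K):ℤP] ≤ w`) VERBATIM. Displayed: {`h52`, `hPT` ∀K, `hF1`, `h372`,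
`hGZK`, `hKo`, `hmod`}. [cite: Jetchev2008, Cor. 1.5 (p. 812)] [cite: Serre1972, §2.8 Prop. 19]
[cite: SilvermanATAEC1994, IV.9.4] [cite: Miller2011LMS, Def. 1.1] -/
theorem bsdp_of_jetRowA5_tam_min_literature (p : ℕ) (hp : p.Prime) (hp5 : 5 ≤ p) (a1 a2 a3 a4 a6 : ℤ)
    (hmin : (⟨a1, a2, a3, a4, a6⟩ : WeierstrassCurve ℚ).IsGloballyMinimal)
    (ℓ₁ ℓ₂ ℓ₃ : ℕ) (hℓ₁ : ℓ₁.Prime) (hℓ₂ : ℓ₂.Prime) (hℓ₃ : ℓ₃.Prime)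
    (h2₁ : ℓ₁ ≠ 2) (h2₂ : ℓ₂ ≠ 2) (h2₃ : ℓ₃ ≠ 2) (hne₁ : ℓ₁ ≠ p) (hne₂ : ℓ₂ ≠ p) (hne₃ : ℓ₃ ≠ p)
    (hΔ₁ : ¬ (ℓ₁ : ℤ) ∣ discOf [a1, a2, a3, a4, a6]) (hΔ₂ : ¬ (ℓ₂ : ℤ) ∣ discOf [a1, a2, a3, a4, a6])
    (hΔ₃ : ¬ (ℓ₃ : ℤ) ∣ discOf [a1, a2, a3, a4, a6])
    {n₁ n₂ n₃ : ℕ} (hc₁ : countPoints [a1, a2, a3, a4, a6] ℓ₁ = n₁)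
    (hc₂ : countPoints [a1, a2, a3, a4, a6] ℓ₂ = n₂) (hc₃ : countPoints [a1, a2, a3, a4, a6] ℓ₃ = n₃)
    (r u : ZMod p)
    (hi : (((ℓ₁ : ℤ) + 1 - n₁ : ℤ) : ZMod p) ^ 2 - 4 * ℓ₁ = r * r ∧
      (((ℓ₁ : ℤ) + 1 - n₁ : ℤ) : ZMod p) ^ 2 - 4 * ℓ₁ ≠ 0 ∧ (((ℓ₁ : ℤ) + 1 - n₁ : ℤ) : ZMod p) ≠ 0)
    (hii : ((((ℓ₂ : ℤ) + 1 - n₂ : ℤ) : ZMod p) ^ 2 - 4 * ℓ₂) ^ (p / 2) = -1 ∧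
      (((ℓ₂ : ℤ) + 1 - n₂ : ℤ) : ZMod p) ≠ 0)
    (hiii : (((ℓ₃ : ℤ) + 1 - n₃ : ℤ) : ZMod p) ^ 2 = u * ℓ₃ ∧
      u ≠ 0 ∧ u ≠ 1 ∧ u ≠ 2 ∧ u ≠ 4 ∧ u ^ 2 - 3 * u + 1 ≠ 0)
    (q : ℕ) (T : TamLocal) (hTq : T.p = q) (hT : T.check ⟨a1, a2, a3, a4, a6⟩ = true)
    {c : ℕ} (hvals : T.vals = [c]) {w : ℕ} (hw : w ≤ padicValNat p c) (hqp : q ≠ p)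
    (h52 : McCallum1991.prop52_exists_conductor_kolyvaginClass_order_eq)
    (hPT : ∀ (K : Type) [Field K] [NumberField K], poitouTate_selmerStructure_duality_conj K)
    (hF1 : Gross1991_heegnerPoint_sub_ratTorsion_mem_E0)
    (h372 : GrossLMS1991.prop37_2_frobeniusCongruence)
    (hGZK : rank_eq_analyticRank_of_analyticRank_le_one)
    (hKo : ∀ (N : ℕ) [NeZero N] (W : WeierstrassCurve ℚ) (K : Type) [Field K] [NumberField K], kolyvagin N W K)
    (hmod : exists_isNewformOf)
    (W : WeierstrassCurve ℚ) (hW : W = ⟨a1, a2, a3, a4, a6⟩)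
    {N : ℕ} [NeZero N] {K : Type} [Field K] [NumberField K] (hK : IsImaginaryQuadratic K)
    (hD3 : NumberField.discr K ≠ -3) (hD4 : NumberField.discr K ≠ -4)
    (hH : SatisfiesHeegnerHypothesis N K) {P : (W.baseChange K).toAffine.Point}
    (hP : IsHeegnerPoint N W K P) (hnt : ¬ IsOfFinAddOrder P) (hqN : q ∣ N)
    (hv : padicValNat p (AddSubgroup.zmultiples P).index ≤ w)
    (hr : W.analyticRank ≤ 1) {s : ℚ} (hs : shaAn W = (s : ℂ)) (hvs : padicValRat p s = 0) :
    BSDp W p := by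
  subst hW
  have h0 : discOf [a1, a2, a3, a4, a6] ≠ 0 := fun h ↦ hΔ₁ (by rw [h]; exact dvd_zero _)
  haveI hE : (⟨a1, a2, a3, a4, a6⟩ : WeierstrassCurve ℚ).IsElliptic :=
    X11b.isElliptic_of_discOf_ne_zero a1 a2 a3 a4 a6 h0
  haveI := hmin
  haveI : Fact (Nat.Prime p) := ⟨hp⟩
  haveI : Fact (Nat.Prime q) := ⟨hTq ▸ (TamLocal.check_common hT).1⟩
  have hI0 : integralModelInt (⟨a1, a2, a3, a4, a6⟩ : WeierstrassCurve ℚ) = ⟨a1, a2, a3, a4, a6⟩ :=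
    integralModelInt_eq_of_map_eq _ (map_mk_int a1 a2 a3 a4 a6)
  -- `ρ̄_{E,p}` onto from the three Serre witnesses (Serre 1972 Prop. 19)
  have hρ : Surj (⟨a1, a2, a3, a4, a6⟩ : WeierstrassCurve ℚ) p :=
    Supersingular.surj_of_ainvs_of_serreWitnesses a1 a2 a3 a4 a6 p hp5 hmin ℓ₁ ℓ₂ ℓ₃ hℓ₁ hℓ₂ hℓ₃
      h2₁ h2₂ h2₃ hne₁ hne₂ hne₃ hΔ₁ hΔ₂ hΔ₃ hc₁ hc₂ hc₃ r u hi hii hiii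
  -- the Tamagawa half in the kernel: `c_q(W/ℚ_q) = c`
  have hcq : ((⟨a1, a2, a3, a4, a6⟩ : WeierstrassCurve ℚ).baseChange ℚ_[q]).localTamagawaNumber ℤ_[q] = c :=
    Additive.IntModelTam.localTamagawaNumber_padic_eq_of_intModel_of_tamLocal hI0 q hTq hT hvals
  have hI : padicValNat p (AddSubgroup.zmultiples P).index ≤ padicValNat p
      (((⟨a1, a2, a3, a4, a6⟩ : WeierstrassCurve ℚ).baseChange ℚ_[q]).localTamagawaNumber ℤ_[q]) := hcq ▸ hv.trans hw
  exact bsdp_of_carrierNeCertificate_level_of_five_le_of_literature h52 hPT hF1 h372 hGZK hKo hmod _ p hK hD3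
    hD4 hH hP hnt hp5 hρ q hqN hqp hI hr hs hvs

/-- **Bucket B, `p ≥ 5` (carrier `q = p`, split `I_n` with `p ∣ n`): `BSD(E,p)` for a literal integer model
from the two-engine HEEGNER-INDEX line through named print only** — `bsdp_of_jetRowB5_tam_min` with
{`hJ`, `hMcU`, `hrec`, `hD36`, `hlev`} fed; certificate inputs VERBATIM. Displayed: {`h52`, `hPT` ∀K, `hF1`,
`h372`, `hGZK`, `hKo`, `hmod`}. [cite: Jetchev2008, Cor. 1.5 (p. 812)] [cite: Serre1972, §2.8 Prop. 19]
[cite: SilvermanAEC2009, VII.5 Prop. 5.1(b)] [cite: SilvermanATAEC1994, IV.9.4] [cite: Wuthrich2014, Lemma 20 (p. 399)] -/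
theorem bsdp_of_jetRowB5_tam_min_literature (p : ℕ) (hp : p.Prime) (hp5 : 5 ≤ p) (a1 a2 a3 a4 a6 : ℤ)
    (hmin : (⟨a1, a2, a3, a4, a6⟩ : WeierstrassCurve ℚ).IsGloballyMinimal)
    (hpΔ : (p : ℤ) ∣ (⟨a1, a2, a3, a4, a6⟩ : WeierstrassCurve ℤ).Δ)
    (hpc₄ : ¬ (p : ℤ) ∣ (⟨a1, a2, a3, a4, a6⟩ : WeierstrassCurve ℤ).c₄)
    (ℓ₁ ℓ₂ ℓ₃ : ℕ) (hℓ₁ : ℓ₁.Prime) (hℓ₂ : ℓ₂.Prime) (hℓ₃ : ℓ₃.Prime)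
    (h2₁ : ℓ₁ ≠ 2) (h2₂ : ℓ₂ ≠ 2) (h2₃ : ℓ₃ ≠ 2) (hne₁ : ℓ₁ ≠ p) (hne₂ : ℓ₂ ≠ p) (hne₃ : ℓ₃ ≠ p)
    (hΔ₁ : ¬ (ℓ₁ : ℤ) ∣ discOf [a1, a2, a3, a4, a6]) (hΔ₂ : ¬ (ℓ₂ : ℤ) ∣ discOf [a1, a2, a3, a4, a6])
    (hΔ₃ : ¬ (ℓ₃ : ℤ) ∣ discOf [a1, a2, a3, a4, a6])
    {n₁ n₂ n₃ : ℕ} (hc₁ : countPoints [a1, a2, a3, a4, a6] ℓ₁ = n₁)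
    (hc₂ : countPoints [a1, a2, a3, a4, a6] ℓ₂ = n₂) (hc₃ : countPoints [a1, a2, a3, a4, a6] ℓ₃ = n₃)
    (r u : ZMod p)
    (hi : (((ℓ₁ : ℤ) + 1 - n₁ : ℤ) : ZMod p) ^ 2 - 4 * ℓ₁ = r * r ∧
      (((ℓ₁ : ℤ) + 1 - n₁ : ℤ) : ZMod p) ^ 2 - 4 * ℓ₁ ≠ 0 ∧ (((ℓ₁ : ℤ) + 1 - n₁ : ℤ) : ZMod p) ≠ 0)
    (hii : ((((ℓ₂ : ℤ) + 1 - n₂ : ℤ) : ZMod p) ^ 2 - 4 * ℓ₂) ^ (p / 2) = -1 ∧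
      (((ℓ₂ : ℤ) + 1 - n₂ : ℤ) : ZMod p) ≠ 0)
    (hiii : (((ℓ₃ : ℤ) + 1 - n₃ : ℤ) : ZMod p) ^ 2 = u * ℓ₃ ∧
      u ≠ 0 ∧ u ≠ 1 ∧ u ≠ 2 ∧ u ≠ 4 ∧ u ^ 2 - 3 * u + 1 ≠ 0)
    (T : TamLocal) (hTp : T.p = p) (hT : T.check ⟨a1, a2, a3, a4, a6⟩ = true)
    {c : ℕ} (hvals : T.vals = [c]) {w : ℕ} (hw : w ≤ padicValNat p c)
    (h52 : McCallum1991.prop52_exists_conductor_kolyvaginClass_order_eq)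
    (hPT : ∀ (K : Type) [Field K] [NumberField K], poitouTate_selmerStructure_duality_conj K)
    (hF1 : Gross1991_heegnerPoint_sub_ratTorsion_mem_E0)
    (h372 : GrossLMS1991.prop37_2_frobeniusCongruence)
    (hGZK : rank_eq_analyticRank_of_analyticRank_le_one)
    (hKo : ∀ (N : ℕ) [NeZero N] (W : WeierstrassCurve ℚ) (K : Type) [Field K] [NumberField K], kolyvagin N W K)
    (hmod : exists_isNewformOf)
    (W : WeierstrassCurve ℚ) (hW : W = ⟨a1, a2, a3, a4, a6⟩)
    {N : ℕ} [NeZero N] {K : Type} [Field K] [NumberField K] (hK : IsImaginaryQuadratic K)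
    (hD3 : NumberField.discr K ≠ -3) (hD4 : NumberField.discr K ≠ -4)
    (hH : SatisfiesHeegnerHypothesis N K) {P : (W.baseChange K).toAffine.Point}
    (hP : IsHeegnerPoint N W K P) (hnt : ¬ IsOfFinAddOrder P)
    (hv : padicValNat p (AddSubgroup.zmultiples P).index ≤ w)
    (hr : W.analyticRank ≤ 1) {s : ℚ} (hs : shaAn W = (s : ℂ)) (hvs : padicValRat p s = 0) :
    BSDp W p := by
  subst hW
  have h0 : discOf [a1, a2, a3, a4, a6] ≠ 0 := fun h ↦ hΔ₁ (by rw [h]; exact dvd_zero _)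
  haveI hE : (⟨a1, a2, a3, a4, a6⟩ : WeierstrassCurve ℚ).IsElliptic :=
    X11b.isElliptic_of_discOf_ne_zero a1 a2 a3 a4 a6 h0
  haveI := hmin
  haveI : Fact (Nat.Prime p) := ⟨hp⟩
  have hI0 : integralModelInt (⟨a1, a2, a3, a4, a6⟩ : WeierstrassCurve ℚ) = ⟨a1, a2, a3, a4, a6⟩ :=
    integralModelInt_eq_of_map_eq _ (map_mk_int a1 a2 a3 a4 a6)
  -- `ρ̄_{E,p}` onto from the three Serre witnesses (Serre 1972 Prop. 19)
  have hρ : Surj (⟨a1, a2, a3, a4, a6⟩ : WeierstrassCurve ℚ) p :=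
    Supersingular.surj_of_ainvs_of_serreWitnesses a1 a2 a3 a4 a6 p hp5 hmin ℓ₁ ℓ₂ ℓ₃ hℓ₁ hℓ₂ hℓ₃
      h2₁ h2₂ h2₃ hne₁ hne₂ hne₃ hΔ₁ hΔ₂ hΔ₃ hc₁ hc₂ hc₃ r u hi hii hiii
  -- multiplicative at the carrier `p`
  have hmult : (⟨a1, a2, a3, a4, a6⟩ : WeierstrassCurve ℚ).HasMultiplicativeReductionAtPrime p :=
    hasMultiplicativeReductionAtPrime_of_intModel hI0 p hpΔ hpc₄
  -- the Tamagawa half in the kernel: `c_p(W/ℚ_p) = c`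
  have hcp : ((⟨a1, a2, a3, a4, a6⟩ : WeierstrassCurve ℚ).baseChange ℚ_[p]).localTamagawaNumber ℤ_[p] = c :=
    Additive.IntModelTam.localTamagawaNumber_padic_eq_of_intModel_of_tamLocal hI0 p hTp hT hvals
  have hI : padicValNat p (AddSubgroup.zmultiples P).index ≤ padicValNat p
      (((⟨a1, a2, a3, a4, a6⟩ : WeierstrassCurve ℚ).baseChange ℚ_[p]).localTamagawaNumber ℤ_[p]) := hcp ▸ hv.trans hw
  exact bsdp_of_carrierMultCertificate_level_of_surj_of_literature h52 hPT hF1 h372 hGZK hKo hmod _ p hK hD3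
    hD4 hH hP hnt (by omega) hmult hρ hI hr hs hvs

end Summit.BirchSwinnertonDyer.Rank1Residual.JET

end
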